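import Literature.NumberTheory.Sieve.BombieriFriedlanderIwaniecAssembly
import Literature.NumberTheory.LFunctions.ChebyshevPsiLogPowerError
import Literature.NumberTheory.LFunctions.SiegelWalfiszMoebiusProofs
import Literature.NumberTheory.Sieve.SieveFrameworkFundamentalLemma
import HarnessLib

/-!
# Bombieri–Friedlander–Iwaniec 1986, Theorem 10: the leaves that the tree already proves

Topic `Literature/NumberTheory/Sieve`, top of the DAG under the named fact
`Literature.NumberTheory.Sieve.bfi_wellFactorable_level` (BFI 1986, Theorem 10: the primes have
well-factorable level `x^{4/7−ε}`).  Everything here is PROVED.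

`Literature.NumberTheory.Sieve.bfi_wellFactorable_level_of_leaves` (`…Assembly.lean`) derives the
fact from nine named inputs.  Three of them are theorems of the tree, and this file feeds them in:

* the **Siegel–Walfisz theorem for `μ`** — `Literature.NumberTheory.LFunctions.SiegelWalfiszMoebius_holds`
  (`SiegelWalfiszMoebiusProofs.lean`, Montgomery–Vaughan §11.3 Exercise 13(f));
* the **fundamental lemma** — `Literature.NumberTheory.Sieve.SieveSequence.fundamental_lemma_uniform_holds`
  (`SieveFrameworkFundamentalLemma.lean`, the beta-sieve);
* the **prime number theorem**.  The reduction of Theorem 10 to its dyadic form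
  (`Literature.NumberTheory.Sieve.BombieriFriedlanderIwaniecTheorem10_of_dyadic`, `…Dyadic.lean`)
  was written against the de la Vallée Poussin error term
  (`Literature.NumberTheory.LFunctions.ChebyshevPsiDeLaValleePoussin`, a named fact) but uses it
  only through its log-power corollary `|ψ(x) − x| ≤ C_A x (log x)^{−A}` (`x ≥ 2`), and that
  corollary is a THEOREM of the tree:
  `Literature.NumberTheory.LFunctions.PsiLogPower.chebyshevPsi_sub_self_isBigO_div_logPow`
  (`ChebyshevPsiLogPowerError.lean`, Titchmarsh §§3.6–3.7).  We restate the corollary in the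
  `∀ x ≥ 2` form (`BFI.chebyshevPsi_logPow_bound`, the compact range `[2, x₀]` being covered by
  Chebyshev's bound) and rerun the reduction verbatim with it
  (`BombieriFriedlanderIwaniecTheorem10_of_dyadic'`).

Result: `Literature.NumberTheory.Sieve.bfi_wellFactorable_level_of_leaves'` — the fact follows from
the SIX remaining named inputs, all deep theorems of the source and of Shiu (1980):
BFI Theorems 1, 2 (dispersion method + Deshouillers–Iwaniec), Theorem 0 (b) (large sieve),
Theorem 5* on boxes, Lemma 3, and Shiu's Brun–Titchmarsh theorem for multiplicative functions.

## References

* E. Bombieri, J. B. Friedlander, H. Iwaniec, *Primes in arithmetic progressions to large moduli*,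
  Acta Math. 156 (1986), 203–251: Theorem 10 p. 209; §15 (15.1) p. 244; §17 p. 249.
  [BombieriFriedlanderIwaniecActa1986]
* H. L. Montgomery, R. C. Vaughan, *Multiplicative Number Theory I*, CUP 2007, Thm. 6.9,
  §11.3 Exercise 13. [MontgomeryVaughan2007]
-/

open Finset Real Filter
open scoped ArithmeticFunction.vonMangoldt Chebyshev

namespace Literature.NumberTheory.Sieve

namespace BFI

/-- **The prime number theorem with a log-power error term, uniform for `x ≥ 2`**: for every real
`A` there is `C` with `|ψ(x) − x| ≤ C x/(log x)^A` for all `x ≥ 2`.  From the tree's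
`chebyshevPsi_sub_self_isBigO_div_logPow` (eventual form) and Chebyshev's bound `ψ(x) ≤ (4 + log 4) x`
on the initial range. [cite: MontgomeryVaughan2007, Theorem 6.9] -/
theorem chebyshevPsi_logPow_bound (A : ℝ) :
    ∃ C : ℝ, ∀ x : ℝ, 2 ≤ x → |ψ x - x| ≤ C * x / Real.log x ^ A := by
  obtain ⟨c, _hc0, hc⟩ :=
    (LFunctions.PsiLogPower.chebyshevPsi_sub_self_isBigO_div_logPow A).exists_pos
  rw [Asymptotics.IsBigOWith, Filter.eventually_atTop] at hc
  obtain ⟨x₀, hx₀⟩ := hc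
  -- the bound `m` for `(log x)^A` on `[2, max x₀ 2]`
  set x₁ : ℝ := max x₀ 2 with hx₁
  set m : ℝ := max (Real.log 2 ^ A) (Real.log x₁ ^ A) with hm
  have hl2 : 0 < Real.log 2 := Real.log_pos one_lt_two
  refine ⟨max c (7 * m), fun x hx => ?_⟩
  have hx0 : 0 < x := by linarith
  have hlx : 0 < Real.log x := Real.log_pos (by linarith)
  have hLA : 0 < Real.log x ^ A := Real.rpow_pos_of_pos hlx A
  have hden : 0 < x / Real.log x ^ A := div_pos hx0 hLA
  rcases le_or_gt x₁ x with hxx₁ | hxx₁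
  · -- large `x`: the asymptotic bound
    have h := hx₀ x ((le_max_left _ _).trans hxx₁)
    rw [Real.norm_eq_abs, Real.norm_eq_abs, abs_of_pos hden] at h
    calc |ψ x - x| ≤ c * (x / Real.log x ^ A) := h
      _ ≤ max c (7 * m) * (x / Real.log x ^ A) :=
          mul_le_mul_of_nonneg_right (le_max_left _ _) hden.le
      _ = max c (7 * m) * x / Real.log x ^ A := by ring
  · -- `2 ≤ x < x₁`: Chebyshev's bound
    have hψ : |ψ x - x| ≤ 7 * x := by
      have h1 : ψ x ≤ (Real.log 4 + 4) * x := Chebyshev.psi_le_const_mul_self hx0.le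
      have hlog4 : Real.log 4 ≤ 3 := by
        have := Real.log_le_sub_one_of_pos (by norm_num : (0 : ℝ) < 4); linarith
      have hψ0 : 0 ≤ ψ x := Chebyshev.psi_nonneg x
      rw [abs_le]; constructor <;> nlinarith
    have hmA : Real.log x ^ A ≤ m := by
      rcases le_or_gt 0 A with hA | hA
      · calc Real.log x ^ A ≤ Real.log x₁ ^ A :=
              Real.rpow_le_rpow hlx.le (Real.log_le_log hx0 hxx₁.le) hA
          _ ≤ m := le_max_right _ _
      · calc Real.log x ^ A ≤ Real.log 2 ^ A :=
              Real.rpow_le_rpow_of_nonpos hl2 (Real.log_le_log two_pos hx) hA.le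
          _ ≤ m := le_max_left _ _
    have hm0 : 0 ≤ m := le_trans hLA.le hmA
    calc |ψ x - x| ≤ 7 * x := hψ
      _ = 7 * Real.log x ^ A * (x / Real.log x ^ A) := by field_simp
      _ ≤ 7 * m * (x / Real.log x ^ A) := by gcongr
      _ ≤ max c (7 * m) * (x / Real.log x ^ A) :=
          mul_le_mul_of_nonneg_right (le_max_right _ _) hden.le
      _ = max c (7 * m) * x / Real.log x ^ A := by ring

end BFI

open BFI

/-- **BFI Theorem 10 from its dyadic form, with the prime number theorem supplied by the tree**:
the reduction `Literature.NumberTheory.Sieve.BombieriFriedlanderIwaniecTheorem10_of_dyadic`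
(BFI §15 p. 244, the decomposition `T₁ + T₂ + T₃` of `…Dyadic.lean`) rerun verbatim with
`BFI.chebyshevPsi_logPow_bound` in place of the named fact `ChebyshevPsiDeLaValleePoussin`.
[cite: BombieriFriedlanderIwaniecActa1986, §15 (15.1) p. 244; §17 p. 249] -/
theorem BombieriFriedlanderIwaniecTheorem10_of_dyadic' (h : Theorem10Dyadic) :
    BombieriFriedlanderIwaniecTheorem10 := by
  intro a ha ε hε A hA
  -- Case `ε > 4/7`: there are no moduli `1 ≤ q ≤ x^{4/7−ε} < 1`.
  by_cases hε47 : 4 / 7 < ε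
  · refine ⟨0, 2, fun x hx lam _ => ?_⟩
    have hQ : ⌊x ^ (4 / 7 - ε)⌋₊ = 0 :=
      Nat.floor_eq_zero.2 (Real.rpow_lt_one_of_one_lt_of_neg (by linarith) (by linarith))
    rw [hQ]
    simp
  push Not at hε47
  -- Main case `ε ≤ 4/7`.
  obtain ⟨C₁, x₁, hC₁⟩ := h a ha (ε / 2) (half_pos hε) (A + 2) (by linarith)
  obtain ⟨CP, hCP⟩ := chebyshevPsi_logPow_bound (A + 2)
  set C₁' : ℝ := max C₁ 0 with hC₁'
  set CP' : ℝ := max CP 0 with hCP'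
  have hC₁'0 : 0 ≤ C₁' := le_max_right _ _
  have hCP'0 : 0 ≤ CP' := le_max_right _ _
  obtain ⟨x₀, hx₀⟩ := Filter.eventually_atTop.1 (eventually_reduction_bounds x₁ A hε)
  refine ⟨C₁' * 2 ^ (A + 2) + 4 * CP' + 32, x₀, fun x hx lam hlam => ?_⟩
  obtain ⟨hx3, hL8, he1, he2, he3, he4, he5⟩ := hx₀ x hx
  -- notation
  set L : ℝ := Real.log x with hL
  set c : ℝ := 4 / 7 - ε with hc
  set Qn : ℕ := ⌊x ^ c⌋₊ with hQn
  set S : Finset ℕ := (Icc 1 Qn).filter (fun q : ℕ => IsCoprime (q : ℤ) a) with hS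
  have hx1 : (1 : ℝ) ≤ x := by linarith
  have hx0 : (0 : ℝ) ≤ x := by linarith
  have hL0 : 0 < L := by linarith
  have hL1 : 1 ≤ L := by linarith
  have hc0 : 0 ≤ c := by rw [hc]; linarith
  have hc1 : c ≤ 1 := by rw [hc]; linarith
  have hxc1 : 1 ≤ x ^ c := Real.one_le_rpow hx1 hc0
  have hxcx : x ^ c ≤ x := by
    conv_rhs => rw [← Real.rpow_one x]
    exact Real.rpow_le_rpow_of_exponent_le hx1 hc1
  have hQnx : (Qn : ℝ) ≤ x ^ c := Nat.floor_le (by positivity)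
  have hQ47 : (Qn : ℝ) ≤ x ^ (4 / 7 : ℝ) :=
    hQnx.trans (Real.rpow_le_rpow_of_exponent_le hx1 (by rw [hc]; linarith))
  have hlogQn : Real.log Qn ≤ L := by
    rcases Nat.eq_zero_or_pos Qn with h0 | hpos
    · rw [h0]; simp [hL0.le]
    · exact Real.log_le_log (by exact_mod_cast hpos) (hQnx.trans hxcx)
  have hlogQn0 : 0 ≤ Real.log Qn := Real.log_natCast_nonneg Qn
  have hlam1 : ∀ q, |lam q| ≤ 1 := hlam.1
  -- the dyadic depth `K` with `L^{A+3} < 2^K ≤ 2 L^{A+3}`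
  have hLA : 1 ≤ L ^ (A + 3) := Real.one_le_rpow hL1 (by linarith)
  obtain ⟨K, hPlow, hPup⟩ := exists_pow_two_near hLA
  have hP0 : (0 : ℝ) < 2 ^ K := by positivity
  -- the lowest point `yK = x / 2^K` and the bottom `m = x / (2 L^{A+3})`
  set yK : ℝ := x / 2 ^ K with hyK
  set m : ℝ := x / (2 * L ^ (A + 3)) with hm
  have hm0 : 0 < 2 * L ^ (A + 3) := by positivity
  have hmyK : m ≤ yK := div_le_div_of_nonneg_left hx0 hP0 hPup
  have hyKup : yK ≤ x / L ^ (A + 3) := div_le_div_of_nonneg_left hx0 (by positivity) hPlow.le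
  have hyKx : yK ≤ x := div_le_self hx0 (one_le_pow₀ one_le_two)
  have hm_ge : max x₁ 2 ≤ m := by
    rw [hm, le_div_iff₀ hm0]; linarith
  have hm2 : 2 ≤ m := (le_max_right _ _).trans hm_ge
  have hm_sqrt : Real.sqrt x ≤ m := by
    rw [hm, le_div_iff₀ hm0]
    calc Real.sqrt x * (2 * L ^ (A + 3)) ≤ Real.sqrt x * Real.sqrt x := by
          refine mul_le_mul_of_nonneg_left ?_ (Real.sqrt_nonneg x)
          rw [Real.le_sqrt (by positivity) hx0]; exact he2
      _ = x := Real.mul_self_sqrt hx0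
  have hlogm : L / 2 ≤ Real.log m := by
    have : Real.log (Real.sqrt x) = L / 2 := by
      rw [hL, Real.log_sqrt hx0]
    rw [← this]
    exact Real.log_le_log (Real.sqrt_pos.2 (by linarith)) hm_sqrt
  -- level comparison: `x^{4/7−ε} ≤ m^{4/7−ε/2}`
  have hlevm : x ^ c ≤ m ^ (4 / 7 - ε / 2) := by
    have hce : 4 / 7 - ε / 2 = c + ε / 2 := by rw [hc]; ring
    rw [hce, hm, Real.div_rpow hx0 hm0.le, le_div_iff₀ (Real.rpow_pos_of_pos hm0 _),
      Real.rpow_add (by linarith : (0 : ℝ) < x)]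
    refine mul_le_mul_of_nonneg_left ?_ (by positivity)
    have hbase : 1 ≤ 2 * L ^ (A + 3) := by linarith
    calc (2 * L ^ (A + 3)) ^ (c + ε / 2) ≤ (2 * L ^ (A + 3)) ^ (1 : ℝ) :=
          Real.rpow_le_rpow_of_exponent_le hbase (by rw [hc]; linarith)
      _ = 2 * L ^ (A + 3) := Real.rpow_one _
      _ ≤ x ^ (ε / 2) := he3
  -- the dyadic hypothesis with a nonnegative constant, for `y ≥ max x₁ 1`
  have hdy : ∀ y : ℝ, max x₁ 1 ≤ y → ∀ lam : ℕ → ℝ, IsWellFactorable (y ^ (4 / 7 - ε / 2)) lam →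
      |∑ q ∈ (Icc 1 ⌊y ^ (4 / 7 - ε / 2)⌋₊).filter (fun q : ℕ => IsCoprime (q : ℤ) a),
          lam q * dyadDisc q a y| ≤ C₁' * y / Real.log y ^ (A + 2) := by
    intro y hy lam' hlam'
    have hy1 : 1 ≤ y := (le_max_right _ _).trans hy
    have hyx₁ : x₁ ≤ y := (le_max_left _ _).trans hy
    refine (hC₁ y hyx₁ lam' hlam').trans ?_
    have h0 : 0 ≤ y / Real.log y ^ (A + 2) :=
      div_nonneg (by linarith) (Real.rpow_nonneg (Real.log_nonneg hy1) _)
    calc C₁ * y / Real.log y ^ (A + 2) = C₁ * (y / Real.log y ^ (A + 2)) := by ring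
      _ ≤ C₁' * (y / Real.log y ^ (A + 2)) := mul_le_mul_of_nonneg_right (le_max_left _ _) h0
      _ = C₁' * y / Real.log y ^ (A + 2) := by ring
  -- basic facts on `yK`
  have hyK1 : 1 ≤ yK := by linarith
  have hyK0 : 0 ≤ yK := by linarith
  have hlogyK : Real.log yK ≤ L := Real.log_le_log (by linarith) hyKx
  have hlogyK0 : 0 ≤ Real.log yK := Real.log_nonneg hyK1
  -- Step A: the decomposition `T₁ + T₂ + T₃`
  have hdecomp : ∀ q : ℕ, lam q * (LevelOfDistribution.chebyshevPsiMod q (a : ZMod q) x - x / (Nat.totient q : ℝ)) =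
      lam q * LevelOfDistribution.chebyshevPsiMod q (a : ZMod q) (x / 2 ^ K) +
        (∑ k ∈ range K, lam q * dyadDisc q a (x / 2 ^ (k + 1))) +
        lam q * ((∑ n ∈ Ioc ⌊x / 2 ^ K⌋₊ ⌊x⌋₊, if n.Coprime q then Λ n else 0) /
          (Nat.totient q : ℝ) - x / (Nat.totient q : ℝ)) := by
    intro q
    have hdisc : ∀ y : ℝ, psiDyadMod q (a : ZMod q) y =
        dyadDisc q a y + psiDyadCoprime q y / (Nat.totient q : ℝ) := fun y => by
      unfold dyadDisc; ring
    rw [chebyshevPsiMod_eq_add_sum_psiDyadMod q _ hx0 K,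
      Finset.sum_congr rfl fun k _ => hdisc (x / 2 ^ (k + 1)), Finset.sum_add_distrib,
      ← Finset.sum_div, sum_psiDyadCoprime_eq q hx0 K, ← Finset.mul_sum]
    ring
  have htotal : ∑ q ∈ S, lam q * (LevelOfDistribution.chebyshevPsiMod q (a : ZMod q) x - x / (Nat.totient q : ℝ)) =
      (∑ q ∈ S, lam q * LevelOfDistribution.chebyshevPsiMod q (a : ZMod q) yK) +
        (∑ k ∈ range K, ∑ q ∈ S, lam q * dyadDisc q a (x / 2 ^ (k + 1))) +
        ∑ q ∈ S, lam q * ((∑ n ∈ Ioc ⌊yK⌋₊ ⌊x⌋₊, if n.Coprime q then Λ n else 0) /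
          (Nat.totient q : ℝ) - x / (Nat.totient q : ℝ)) := by
    rw [Finset.sum_congr rfl fun q _ => hdecomp q, Finset.sum_add_distrib, Finset.sum_add_distrib,
      Finset.sum_comm]
  -- Step B: `T₁ ≤ 3 x / L^A`
  have hT1 : |∑ q ∈ S, lam q * LevelOfDistribution.chebyshevPsiMod q (a : ZMod q) yK| ≤ 3 * x / L ^ A :=
    (abs_sum_mul_chebyshevPsiMod_le Qn _ hlam1 a hyK1).trans
      (reduction_T1_arith hL0 hL1 hx1 hyK0 hyKup hlogyK (Nat.cast_nonneg Qn) hQ47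
        hlogQn hlogQn0 he4)
  -- Step B: `T₂ ≤ C₁' 2^{A+2} x / L^A`
  have hT2 : ∑ k ∈ range K, |∑ q ∈ S, lam q * dyadDisc q a (x / 2 ^ (k + 1))| ≤
      C₁' * 2 ^ (A + 2) * x / L ^ A := by
    have hpiece : ∀ k ∈ range K, |∑ q ∈ S, lam q * dyadDisc q a (x / 2 ^ (k + 1))| ≤
        C₁' * 2 ^ (A + 2) * (x / 2 ^ (k + 1)) / L ^ (A + 2) := by
      intro k hk
      have hkK : k + 1 ≤ K := mem_range.1 hk
      have hyKy : yK ≤ x / 2 ^ (k + 1) :=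
        div_le_div_of_nonneg_left hx0 (by positivity) (pow_le_pow_right₀ one_le_two hkK)
      have hmy : m ≤ x / 2 ^ (k + 1) := hmyK.trans hyKy
      have hmpos : 0 < m := by linarith
      have hx₁y : max x₁ 1 ≤ x / 2 ^ (k + 1) :=
        (max_le_max le_rfl one_le_two).trans (hm_ge.trans hmy)
      have hlev : x ^ c ≤ (x / 2 ^ (k + 1)) ^ (4 / 7 - ε / 2) :=
        hlevm.trans (Real.rpow_le_rpow hmpos.le hmy (by linarith))
      have hlog : L / 2 ≤ Real.log (x / 2 ^ (k + 1)) := hlogm.trans (Real.log_le_log hmpos hmy)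
      exact abs_dyadic_piece_le (a := a) (ε := ε) hC₁'0 (by linarith : 0 < A + 2) hdy hx₁y
        (hyK0.trans hyKy) hxc1 hlev hL0 hlog hlam
    refine (Finset.sum_le_sum hpiece).trans ?_
    have hsum : ∑ k ∈ range K, C₁' * 2 ^ (A + 2) * (x / 2 ^ (k + 1)) / L ^ (A + 2) =
        C₁' * 2 ^ (A + 2) / L ^ (A + 2) * (x * (1 - 1 / 2 ^ K)) := by
      rw [← sum_range_div_two_pow_succ, Finset.mul_sum]
      refine Finset.sum_congr rfl fun k _ => ?_
      ring
    rw [hsum]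
    exact reduction_T2_arith K hL0 hL1 hx0 hC₁'0
  -- Step B: `T₃ ≤ (4 CP' + 29) x / L^A`
  have hT3 : |∑ q ∈ S, lam q * ((∑ n ∈ Ioc ⌊yK⌋₊ ⌊x⌋₊, if n.Coprime q then Λ n else 0) /
        (Nat.totient q : ℝ) - x / (Nat.totient q : ℝ))| ≤ (4 * CP' + 29) * x / L ^ A := by
    refine (abs_sum_mul_coprime_main_le Qn _ hlam1 hyK1 hyKx).trans ?_
    have hψx : |ψ x - x| ≤ CP' * x / L ^ (A + 2) := by
      refine (hCP x (by linarith)).trans ?_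
      have h0 : 0 ≤ x / L ^ (A + 2) := by positivity
      calc CP * x / Real.log x ^ (A + 2) = CP * (x / L ^ (A + 2)) := by rw [hL]; ring
        _ ≤ CP' * (x / L ^ (A + 2)) := mul_le_mul_of_nonneg_right (le_max_left _ _) h0
        _ = CP' * x / L ^ (A + 2) := by ring
    have hψyK : ψ yK ≤ 7 * (x / L ^ (A + 3)) := by
      refine (Chebyshev.psi_le_const_mul_self hyK0).trans ?_
      have hlog4 : Real.log 4 ≤ 3 := by
        have := Real.log_le_sub_one_of_pos (by norm_num : (0 : ℝ) < 4); linarith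
      calc (Real.log 4 + 4) * yK ≤ 7 * yK := mul_le_mul_of_nonneg_right (by linarith) hyK0
        _ ≤ 7 * (x / L ^ (A + 3)) := by gcongr
    simpa only [hL] using reduction_T3_arith hL0 hL1 hx0 hψx hψyK hlogQn hlogQn0 he5
  -- conclusion
  have habs : |∑ q ∈ S, lam q * (LevelOfDistribution.chebyshevPsiMod q (a : ZMod q) x - x / (Nat.totient q : ℝ))| ≤
      3 * x / L ^ A + C₁' * 2 ^ (A + 2) * x / L ^ A + (4 * CP' + 29) * x / L ^ A := by
    rw [htotal]
    refine (abs_add_le _ _).trans (add_le_add ((abs_add_le _ _).trans (add_le_add hT1 ?_)) hT3)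
    exact (Finset.abs_sum_le_sum_abs _ _).trans hT2
  refine habs.trans (le_of_eq ?_)
  rw [hL]
  ring

/-- **BFI Theorem 10 (as printed) from the six deep leaves**: Theorems 1, 2, 0 (b), 5* (on
boxes), Lemma 3 of the source and Shiu's theorem; the Siegel–Walfisz theorem for `μ`, the
fundamental lemma and the prime number theorem are supplied by the tree.
[cite: BombieriFriedlanderIwaniecActa1986, Theorem 10 p. 209] -/
theorem BombieriFriedlanderIwaniecTheorem10_of_leaves'
    (h1 : BombieriFriedlanderIwaniecTheorem1) (h2 : BombieriFriedlanderIwaniecTheorem2)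
    (h0b : BombieriFriedlanderIwaniecTheorem0b) (h5 : BombieriFriedlanderIwaniecTheorem5StarInterval)
    (hL3 : BombieriFriedlanderIwaniecLemma3) (hShiu : Shiu1980BrunTitchmarsh) :
    BombieriFriedlanderIwaniecTheorem10 :=
  BombieriFriedlanderIwaniecTheorem10_of_dyadic'
    (Theorem10Dyadic_of_leaves h1 h2 h0b h5 hL3 hShiu LFunctions.SiegelWalfiszMoebius_holds
      SieveSequence.fundamental_lemma_uniform_holds)

/-- **The tree's fact `bfi_wellFactorable_level` from the six deep leaves** (BFI Theorems 1, 2,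
0 (b), 5* on boxes, Lemma 3; Shiu 1980), the other three inputs of
`bfi_wellFactorable_level_of_leaves` being theorems of the tree.
[cite: BombieriFriedlanderIwaniecActa1986, Theorem 10 p. 209] -/
theorem bfi_wellFactorable_level_of_leaves'
    (h1 : BombieriFriedlanderIwaniecTheorem1) (h2 : BombieriFriedlanderIwaniecTheorem2)
    (h0b : BombieriFriedlanderIwaniecTheorem0b) (h5 : BombieriFriedlanderIwaniecTheorem5StarInterval)
    (hL3 : BombieriFriedlanderIwaniecLemma3) (hShiu : Shiu1980BrunTitchmarsh) :
    bfi_wellFactorable_level :=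
  bfi_wellFactorable_level_of_theorem10
    (BombieriFriedlanderIwaniecTheorem10_of_leaves' h1 h2 h0b h5 hL3 hShiu)

end Literature.NumberTheory.Sieve
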